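import Literature.NumberTheory.EllipticCurves.Rank1Residual.X1RankZeroCertificate
import Summits.BirchSwinnertonDyer.BirchSwinnertonDyer.Theorems.EisensteinPrimesMazurMCOnX1RankZeroSecondDescentAlgebra
import Summits.BirchSwinnertonDyer.Rank1Residual.X1.RankZero
import HarnessLib

/-!
# Row A3 per pair, SECOND LAYER: `BSD(E,p)` and Mazur's main conjecture at a rank-`0` X1 pair with
# `ord_p #Ш_an = 4` from PUBLISHED theorems plus the finite certificate "the Cassels–Tate pairing
# vanishes on `Ш(E)[p]`" (cell `bsd-eis`, seat `bsd-eis-k5-c5` g3; crux 5 `MazurMCOnX1RankZero`,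
# item stmt-BirchSwinnertonDyer-19035; THEOREMS ONLY, nothing booked)

HONEST FRAMING (FULL-BSD rank-≤1 programme D-0033, cell `bsd-eis`, home `run/shared/lean/pub/bsd-eis/`;
ladder row A3 = class X1 ∩ {r_an = 0}: good ANOMALOUS Eisenstein prime `p > 2`, `E[p]` reducible, parity
type A; crux 5 `Summit.BirchSwinnertonDyer.BirchSwinnertonDyer.Theses.EisensteinPrimes.MazurMCOnX1RankZero`
of route `EisensteinPrimes`, which stays OPEN — nothing class-wide is claimed and nothing is booked
by this file). BSD is not proved for any curve by this file alone: every theorem takes PUBLISHED named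
facts of the tree as hypotheses (`hCT` Cassels–Tate pairing bsd.S18, `hW` Wuthrich 2014 Prop. 21,
`hGZK` Gross–Zagier–Kolyvagin bsd.S17, `hmod` modularity, `hCassels` Cassels 1965 / Milne ADT I.7.3,
and for Mazur's main conjecture `hW16` Wuthrich 2014 Thm. 16, `hGr` Greenberg 1999 Thm. 4.1,
`hmodP` modular parametrisation) plus a FINITE CERTIFICATE read from instruments.

**The shape this file adds** (the "second layer" above the first-descent door
`X1.bsdp_of_casselsTate_of_exists_torsion` of `Rank1Residual/X1RankZeroCertificate.lean`, which needs
`ord_p #Ш(E)_an ≤ 2`). On the census of row A3 (149 cells, 146 at `p = 3`) the descent-certificate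
road of `bsd-litref` (`OFFER-DESC3-A10A3`, referee A ROUND 571) certifies 136 cells and leaves 13 whose
isogeny class `{E₁ —φ→ E₂}` (`φ` of degree `3`, kernel `⟨T⟩`, `T ∈ E₁(ℚ)` of order `3`) has the shape
`#Ш_an(E₁) = 9`, `Ш(E₁)[φ] = 0`, `#Ш_an(E₂) = 81`, `Ш(E₂)[φ̂] ≅ (ℤ/3)²` (two engines, `sha-2`'s
`isogchi.gp` / `isogcft.gp`): the first descent sees `Ш[3] ≠ 0` only on `E₂`, where `ord_3 #Ш_an = 4 > 2`.
The missing bit is the CASSELS–TATE PAIRING on `Ш(E₂)[φ̂] = Ш(E₂)[3]` (equality because `Ш(E₁)[φ] = 0`):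
if it VANISHES identically there — the BSD-consistent outcome, and what the cell's run of the
`b2b-bsdres` engine `ctp3iso` 0.2.2 (van Beek–Fisher, Acta Arith. 185 (2018): the pairing on
`S^{(φ̂)}(E₂/ℚ)` via cubic norm equations) returns on all 11 NOCERT cells, verdict `DEGENERATE(2)`, matrix
`0` (kit j272411; re-read with the custodian's five NONDEG controls first in ONE job, kit j272840, and
on a second local route `Z3K(5)`/`Z3K(13)`/`K-LIFT`, kit j272823 — 43/43 records consistent) — then, the pairing being alternating and non-degenerate on the
finite group `Ш(E₂)` (Cassels 1962; Milne ADT I.6.13; tree fact `exists_casselsTate_pairing`),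
`Ш(E₂)[3] ⊆ (Ш(E₂)[3])^⊥ = 3·Ш(E₂)` (the orthogonal of the `p`-torsion is `pШ`, tree theorem
`FiniteAbelian.mem_range_nsmul_of_forall_torsionBy`), so `Ш(E₂)[3^∞]`, which is non-cyclic
(`#Ш[3] = 3^{2k}`, `k ≥ 1`), contains `(ℤ/9)²`: **`3⁴ ∣ #Ш(E₂)`**. With Wuthrich's upper bound
`ord_3 #Ш(E₂) ≤ ord_3 #Ш_an(E₂) = 4` this is `BSD(E₂,3)`, by Cassels' isogeny invariance `BSD(E₁,3)`, and
by the converse chain (Wuthrich Thm. 16 + Greenberg Thm. 4.1) Mazur's main conjecture at both pairs.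
The general statement proved here: at a rank-`0` pair with `ord_p #Ш_an ≤ 4`, the two READ data
`Ш(E)[p] ≠ 0` and `Ш(E)[p] ⊆ pШ(E)` give `BSD(E,p)`.

**This file proves** (the doors; the algebra is the sibling `…SecondDescentAlgebra.lean`; no `sorry`, no new
definition, no named fact):
* (sibling §1) `pow_four_dvd_natCard_of_alternating_of_inf_ne_bot` — a finite abelian group with an alternating
  non-degenerate `ℚ/ℤ`-valued pairing and `T[p] ∩ pT ≠ 0` has `p⁴ ∣ #T` (`#T = #pT · #T[p]`, and
  `T[p] ∩ pT ≅ (T/T[p])[p]` has even `p`-rank for the induced pairing on `T/T[p]` — tree theorems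
  `natCard_torsionBy_quot_eq`, `exists_quotTorsionPairing`, `exists_natCard_torsionBy_eq_pow_two_mul_of_circle`);
  the three certificate shapes feeding it: `T[p] ≠ 0 ∧ T[p] ⊆ pT`, an element of order `p²`, and
  "every alternating non-degenerate pairing vanishes on `T[p] × T[p]`" (`forall_exists_nsmul_of_pairing_eq_zero`);
* (sibling §2) `pow_four_dvd_shaOrder_of_casselsTate_of_…` — the same for `Ш(E/K)` finite over a number field,
  with the pairing supplied by `exists_casselsTate_pairing` (three shapes);
* §3 `X1.bsdp_of_casselsTate_of_secondDescent` (+ class-free `bsdp_of_wuthrich_of_casselsTate_of_secondDescent`,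
  the order-`p²` form, and the ISOGENOUS form `…_of_isIsogenous` = certificate on `E₂`, conclusion on
  `E₁`) — `BSDp`; §4 `X1.mazurMainConjecture_of_casselsTate_of_secondDescent{,_of_isIsogenous}`,
  `X1.pair_of_…` — `Rank1ResidualX1Defs.MazurMainConjecture W p`, the crux's conclusion, at such pairs.

Census instances (EVIDENCE, not hypotheses of any theorem here; seat memo `HOME/k5-c5-MEMO-2.md`
ADDENDUM v1.12): the 11 A3 cells 58646f, 104420c, 242182g, 296450jp, 332350de, 350170t, 365170o,
376402f, 405548f, 458260e, 461150j at `p = 3` (certificate on the member `E₂` with `#Ш_an = 81`;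
`296450jp` has kernel `ℤ/3(χ₃₈₅)` instead of a rational point, same shape). The cell `332350de` is the
one A3 cell that had no road before 2026-08-27 (planner RULING L49); it now has two (this door, and the
double-twist display `X1/DoubleTwistDisplay332350de1.lean`).

References: Cassels 1962 [Cassels1962ArithmeticIV]; Milne *ADT* I.6.13, I.7.3 [MilneADT2006];
Silverman AEC X.4.14 [SilvermanAEC2009]; Wuthrich 2014 Prop. 21 / Thm. 16 [Wuthrich2014]; Greenberg LNM
1716 Thm. 4.1 [GreenbergLNM1716]; van Beek–Fisher, Acta Arith. 185 (2018) 367–396 (the instrument's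
method); Fisher, J. Number Theory 98 (2003) Thm. 3; Miller 2011 Def. 1.1 [Miller2011LMS].
-/

set_option autoImplicit false
set_option linter.dupNamespace false

noncomputable section

open scoped Classical MatrixGroups ModularForm AddSubgroup

open CongruenceSubgroup WeierstrassCurve Literature.NumberTheory.EllipticCurves
  Literature.NumberTheory.EllipticCurves.ModularForms
  Literature.NumberTheory.EllipticCurves.Wuthrich2014
  Literature.NumberTheory.EllipticCurves.Rank1Residual
  Literature.NumberTheory.EllipticCurves.Rank1Residual.Typed
  Literature.GroupTheory.FiniteAbelian
  Summit.BirchSwinnertonDyer.BirchSwinnertonDyer.Theorems.EisensteinPrimesMazurMCOnX1RankZeroSecondDescentAlgebra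

universe u

namespace Summit.BirchSwinnertonDyer.BirchSwinnertonDyer.Theorems.EisensteinPrimesMazurMCOnX1RankZeroSecondDescent

/-! ### §3 `BSD(E,p)` at a rank-`0` pair with `ord_p #Ш_an ≤ 4` from the second-layer certificate -/

section BSD

variable (W : WeierstrassCurve ℚ) [W.IsElliptic] [W.IsGloballyMinimal] (p : ℕ) [Fact p.Prime]

/-- **Class-free engine.** Rank `0`, odd non-additive `p`, Borel-or-surjective image, `ord_p #Ш_an ≤ 4`,
and the second-layer certificate `Ш(E)[p] ≠ 0`, `Ш(E)[p] ⊆ pШ(E)` ⇒ `BSD(E,p)`: Wuthrich 2014 Prop. 21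
(`hW`, upper half), Cassels–Tate (`hCT`) + certificate ⇒ `p⁴ ∣ #Ш` hence `p³ ∣ #Ш` (lower half,
`Typed.bsdp_of_wuthrich_of_casselsTate_of_pow_dvd` with `k = 2`), `Ш` finite and rank `0` by
Gross–Zagier–Kolyvagin (`hGZK`), modularity (`hmod`). [cite: Wuthrich2014, Prop. 21 (p. 400)]
[cite: SilvermanAEC2009, Thm. X.4.14] [cite: Miller2011LMS, §1 and Def. 1.1] -/
theorem bsdp_of_wuthrich_of_casselsTate_of_secondDescent (hCT : exists_casselsTate_pairing (K := ℚ))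
    (hW : sha_dvd_analyticSha) (hGZK : rank_eq_analyticRank_of_analyticRank_le_one)
    (hmod : hasEntireLFunction_rat) (hp : p ≠ 2) (hr0 : W.analyticRank = 0)
    (hadd : ¬ ((W.baseChange ℚ_[p]).minimal ℤ_[p]).HasAdditiveReduction ℤ_[p])
    (himg : ¬ W.HasIrreducibleModPGaloisRep p ∨ W.HasSurjectiveModNGaloisRep p)
    {q : ℚ} (hq : shaAn W = (q : ℂ)) (hv : padicValRat p q ≤ 4)
    (hx : ∃ x : W.sha, x ≠ 0 ∧ p • x = 0) (hdiv : ∀ x : W.sha, p • x = 0 → ∃ y : W.sha, p • y = x) :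
    BSDp W p :=
  bsdp_of_wuthrich_of_casselsTate_of_pow_dvd W p hCT hW hGZK hmod hp hr0 hadd himg hq (k := 2)
    (by simpa using hv)
    ((pow_dvd_pow p (by norm_num)).trans
      (pow_four_dvd_shaOrder_of_casselsTate_of_forall_exists_nsmul W p hCT (hGZK W (by omega)).2
        hx hdiv))

/-- **X1 ∧ `r = 0`, `ord_p #Ш_an ≤ 4`, second-layer certificate ⇒ `BSD(E,p)`** (canonical shape
`r_an ≤ 1 → ClassX1 W p → r_an = 0 → … → BSDp W p`; on X1, `p` is odd, good hence not additive, `E[p]`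
reducible hence Borel image). The certificate: `hx` = `Ш(E)[p] ≠ 0` (a first `p`-isogeny descent with
`Sel^{φ̂} ⊋ δ(E'(ℚ))`), `hdiv` = `Ш(E)[p] ⊆ pШ(E)` (the Cassels–Tate pairing vanishes on `Ш(E)[p]`;
`Ш(E)[p] = Ш(E)[φ̂]` when the partner's `Ш(E')[φ] = 0`). [cite: Wuthrich2014, Prop. 21 (p. 400)]
[cite: SilvermanAEC2009, Thm. X.4.14] [cite: Miller2011LMS, §1 and Def. 1.1] -/
theorem X1.bsdp_of_casselsTate_of_secondDescent (hCT : exists_casselsTate_pairing (K := ℚ))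
    (hW : sha_dvd_analyticSha) (hGZK : rank_eq_analyticRank_of_analyticRank_le_one)
    (hmod : hasEntireLFunction_rat)
    (hr : W.analyticRank ≤ 1) (hX : ClassX1 W p) (hr0 : W.analyticRank = 0)
    {q : ℚ} (hq : shaAn W = (q : ℂ)) (hv : padicValRat p q ≤ 4)
    (hx : ∃ x : W.sha, x ≠ 0 ∧ p • x = 0) (hdiv : ∀ x : W.sha, p • x = 0 → ∃ y : W.sha, p • y = x) :
    BSDp W p :=
  X1.bsdp_of_casselsTate_of_pow_dvd hCT hW hGZK hmod W p hr hX hr0 hq (k := 2) (by simpa using hv)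
    ((pow_dvd_pow p (by norm_num)).trans
      (pow_four_dvd_shaOrder_of_casselsTate_of_forall_exists_nsmul W p hCT (hGZK W (by omega)).2
        hx hdiv))

/-- **The order-`p²` form:** X1 ∧ `r = 0`, `ord_p #Ш_an ≤ 4`, and ONE element of `Ш(E/ℚ)` of order `p²`
⇒ `BSD(E,p)`. [cite: Wuthrich2014, Prop. 21 (p. 400)] [cite: SilvermanAEC2009, Thm. X.4.14]
[cite: Miller2011LMS, §1 and Def. 1.1] -/
theorem X1.bsdp_of_casselsTate_of_addOrderOf_eq_sq (hCT : exists_casselsTate_pairing (K := ℚ))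
    (hW : sha_dvd_analyticSha) (hGZK : rank_eq_analyticRank_of_analyticRank_le_one)
    (hmod : hasEntireLFunction_rat)
    (hr : W.analyticRank ≤ 1) (hX : ClassX1 W p) (hr0 : W.analyticRank = 0)
    {q : ℚ} (hq : shaAn W = (q : ℂ)) (hv : padicValRat p q ≤ 4)
    (hx : ∃ x : W.sha, addOrderOf x = p ^ 2) : BSDp W p :=
  X1.bsdp_of_casselsTate_of_pow_dvd hCT hW hGZK hmod W p hr hX hr0 hq (k := 2) (by simpa using hv)
    ((pow_dvd_pow p (by norm_num)).trans
      (pow_four_dvd_shaOrder_of_casselsTate_of_addOrderOf_eq_sq W p hCT (hGZK W (by omega)).2 hx))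

/-- **The certificate on an ISOGENOUS curve** (the census shape: `W = E₁` with `#Ш_an = 9` is the
record / leaf curve, `W' = E₂` with `#Ш_an = 81` carries the certificate): if `W ∼ W'` over `ℚ`
(globally minimal models), `(W',p)` is of class X1, `L(W,1) ≠ 0`, `#Ш(W'/ℚ)_an = q'` with
`ord_p q' ≤ 4`, `Ш(W')[p] ≠ 0` and `Ш(W')[p] ⊆ pШ(W')`, then `BSDp W p` — `BSD(W',p)` by
`X1.bsdp_of_casselsTate_of_secondDescent` (`L(W',1) = L(W,1)` by Faltings), transported by Cassels'
isogeny invariance (`hCassels`, `bsdp_of_isIsogenous`). [cite: Wuthrich2014, Prop. 21 (p. 400)]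
[cite: SilvermanAEC2009, Thm. X.4.14] [cite: MilneADT2006, Thm. I.7.3] [cite: Miller2011LMS, §1 and Def. 1.1] -/
theorem X1.bsdp_of_casselsTate_of_secondDescent_of_isIsogenous
    (hCT : exists_casselsTate_pairing (K := ℚ))
    (hW : sha_dvd_analyticSha) (hGZK : rank_eq_analyticRank_of_analyticRank_le_one)
    (hmod : hasEntireLFunction_rat) (hCassels : bsdRHS_eq_of_isIsogenous)
    (W' : WeierstrassCurve ℚ) [W'.IsElliptic] [W'.IsGloballyMinimal] (hiso : IsIsogenous W W')
    (_hr : W.analyticRank ≤ 1) (hX' : ClassX1 W' p) (hL : W.entireLFunction 1 ≠ 0)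
    {q' : ℚ} (hq' : shaAn W' = (q' : ℂ)) (hv' : padicValRat p q' ≤ 4)
    (hx' : ∃ x : W'.sha, x ≠ 0 ∧ p • x = 0)
    (hdiv' : ∀ x : W'.sha, p • x = 0 → ∃ y : W'.sha, p • y = x) : BSDp W p := by
  have hL' : W'.entireLFunction 1 ≠ 0 := by
    rwa [← entireLFunction_eq_of_isIsogenous' hiso]
  have hr0' : W'.analyticRank = 0 := analyticRank_eq_zero_of_entireLFunction_one_ne_zero W' hL'
  have h' : BSDp W' p :=
    X1.bsdp_of_casselsTate_of_secondDescent W' p hCT hW hGZK hmod (by omega) hX' hr0' hq' hv' hx'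
      hdiv'
  obtain ⟨-, hfin'⟩ := hGZK W' (by rw [hr0']; exact zero_le_one)
  have hlead : W'.leadingLCoeff ≠ 0 := by
    rwa [W'.leadingLCoeff_eq_of_analyticRank_eq_zero hr0']
  exact bsdp_of_isIsogenous hCassels hiso hfin' hlead h'

/-- The same with `W.analyticRank = 0` in place of `L(W,1) ≠ 0` (modularity converts).
[cite: Wuthrich2014, Prop. 21 (p. 400)] [cite: MilneADT2006, Thm. I.7.3] [cite: BCDTJAMS2001, Theorem A] -/
theorem X1.bsdp_of_casselsTate_of_secondDescent_of_isIsogenous_of_analyticRank_eq_zero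
    (hCT : exists_casselsTate_pairing (K := ℚ))
    (hW : sha_dvd_analyticSha) (hGZK : rank_eq_analyticRank_of_analyticRank_le_one)
    (hmod : hasEntireLFunction_rat) (hCassels : bsdRHS_eq_of_isIsogenous)
    (W' : WeierstrassCurve ℚ) [W'.IsElliptic] [W'.IsGloballyMinimal] (hiso : IsIsogenous W W')
    (hr : W.analyticRank ≤ 1) (hX' : ClassX1 W' p) (hr0 : W.analyticRank = 0)
    {q' : ℚ} (hq' : shaAn W' = (q' : ℂ)) (hv' : padicValRat p q' ≤ 4)
    (hx' : ∃ x : W'.sha, x ≠ 0 ∧ p • x = 0)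
    (hdiv' : ∀ x : W'.sha, p • x = 0 → ∃ y : W'.sha, p • y = x) : BSDp W p :=
  X1.bsdp_of_casselsTate_of_secondDescent_of_isIsogenous W p hCT hW hGZK hmod hCassels W' hiso hr hX'
    ((W.analyticRank_eq_zero_iff_holds (hmod W)).mp hr0) hq' hv' hx' hdiv'

end BSD

/-! ### §4 Mazur's main conjecture at such pairs (the crux's conclusion, per pair) -/

section MainConjecture

variable (W : WeierstrassCurve ℚ) [W.IsElliptic] [W.IsGloballyMinimal] (p : ℕ) [Fact p.Prime]

/-- **Mazur's main conjecture `Rank1ResidualX1Defs.MazurMainConjecture W p` — the conclusion of crux 5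
`MazurMCOnX1RankZero` — at a rank-`0` X1 pair with `ord_p #Ш_an ≤ 4` and the second-layer certificate**
(`Ш(E)[p] ≠ 0`, `Ш(E)[p] ⊆ pШ(E)`): `BSD(E,p)` by §3, then the converse chain Wuthrich Thm. 16 (`hW16`)
+ Greenberg Thm. 4.1 (`hGr`) (`Rank1ResidualX1Converse.mazurMainConjecture_iff_bsdp`). All inputs by
name are PUBLISHED; the certificate is per curve. [cite: GreenbergLNM1716, Thm. 4.1]
[cite: Wuthrich2014, Thm. 16 (p. 397) and Prop. 21 (p. 400)] [cite: SilvermanAEC2009, Thm. X.4.14] -/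
theorem X1.mazurMainConjecture_of_casselsTate_of_secondDescent
    (hCT : exists_casselsTate_pairing (K := ℚ)) (hW : sha_dvd_analyticSha)
    (hW16 : charIdeal_dvd_padicLFunction) (hGr : greenberg_charValue_rankZero)
    (hmodP : nonempty_modularParametrizationData) (hmod : hasEntireLFunction_rat)
    (hGZK : rank_eq_analyticRank_of_analyticRank_le_one)
    (hX : ClassX1 W p) (hr0 : W.analyticRank = 0)
    {q : ℚ} (hq : shaAn W = (q : ℂ)) (hv : padicValRat p q ≤ 4)
    (hx : ∃ x : W.sha, x ≠ 0 ∧ p • x = 0) (hdiv : ∀ x : W.sha, p • x = 0 → ∃ y : W.sha, p • y = x) :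
    Rank1ResidualX1Defs.MazurMainConjecture W p :=
  (Rank1ResidualX1Converse.mazurMainConjecture_iff_bsdp hW16 hGr hmodP hGZK W p hX hr0).mpr
    (X1.bsdp_of_casselsTate_of_secondDescent W p hCT hW hGZK hmod (by omega) hX hr0 hq hv hx hdiv)

/-- **Mazur's main conjecture at the RECORD curve from the certificate on its ISOGENOUS partner**
(census shape: record `E₁`, certificate on `E₂`): `BSDp E₁ p` by
`X1.bsdp_of_casselsTate_of_secondDescent_of_isIsogenous_of_analyticRank_eq_zero`, then the converse
chain at `(E₁,p)`. [cite: GreenbergLNM1716, Thm. 4.1] [cite: Wuthrich2014, Thm. 16 (p. 397) and Prop. 21 (p. 400)]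
[cite: MilneADT2006, Thm. I.7.3] -/
theorem X1.mazurMainConjecture_of_casselsTate_of_secondDescent_of_isIsogenous
    (hCT : exists_casselsTate_pairing (K := ℚ)) (hW : sha_dvd_analyticSha)
    (hW16 : charIdeal_dvd_padicLFunction) (hGr : greenberg_charValue_rankZero)
    (hmodP : nonempty_modularParametrizationData) (hmod : hasEntireLFunction_rat)
    (hGZK : rank_eq_analyticRank_of_analyticRank_le_one) (hCassels : bsdRHS_eq_of_isIsogenous)
    (W' : WeierstrassCurve ℚ) [W'.IsElliptic] [W'.IsGloballyMinimal] (hiso : IsIsogenous W W')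
    (hX : ClassX1 W p) (hX' : ClassX1 W' p) (hr0 : W.analyticRank = 0)
    {q' : ℚ} (hq' : shaAn W' = (q' : ℂ)) (hv' : padicValRat p q' ≤ 4)
    (hx' : ∃ x : W'.sha, x ≠ 0 ∧ p • x = 0)
    (hdiv' : ∀ x : W'.sha, p • x = 0 → ∃ y : W'.sha, p • y = x) :
    Rank1ResidualX1Defs.MazurMainConjecture W p :=
  (Rank1ResidualX1Converse.mazurMainConjecture_iff_bsdp hW16 hGr hmodP hGZK W p hX hr0).mpr
    (X1.bsdp_of_casselsTate_of_secondDescent_of_isIsogenous_of_analyticRank_eq_zero W p hCT hW hGZK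
      hmod hCassels W' hiso (by omega) hX' hr0 hq' hv' hx' hdiv')

/-- **Both pairs of the class at once** (census shape): under the hypotheses of the previous theorem,
Mazur's main conjecture holds at `(E₁,p)` AND at `(E₂,p)`, and `BSD(E₁,p) ∧ BSD(E₂,p)`.
[cite: GreenbergLNM1716, Thm. 4.1] [cite: Wuthrich2014, Thm. 16 (p. 397) and Prop. 21 (p. 400)]
[cite: MilneADT2006, Thm. I.7.3] -/
theorem X1.pair_of_casselsTate_of_secondDescent_of_isIsogenous
    (hCT : exists_casselsTate_pairing (K := ℚ)) (hW : sha_dvd_analyticSha)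
    (hW16 : charIdeal_dvd_padicLFunction) (hGr : greenberg_charValue_rankZero)
    (hmodP : nonempty_modularParametrizationData) (hmod : hasEntireLFunction_rat)
    (hGZK : rank_eq_analyticRank_of_analyticRank_le_one) (hCassels : bsdRHS_eq_of_isIsogenous)
    (W' : WeierstrassCurve ℚ) [W'.IsElliptic] [W'.IsGloballyMinimal] (hiso : IsIsogenous W W')
    (hX : ClassX1 W p) (hX' : ClassX1 W' p) (hr0 : W.analyticRank = 0)
    {q' : ℚ} (hq' : shaAn W' = (q' : ℂ)) (hv' : padicValRat p q' ≤ 4)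
    (hx' : ∃ x : W'.sha, x ≠ 0 ∧ p • x = 0)
    (hdiv' : ∀ x : W'.sha, p • x = 0 → ∃ y : W'.sha, p • y = x) :
    (BSDp W p ∧ BSDp W' p) ∧
      (Rank1ResidualX1Defs.MazurMainConjecture W p ∧ Rank1ResidualX1Defs.MazurMainConjecture W' p) := by
  have hL : W.entireLFunction 1 ≠ 0 := (W.analyticRank_eq_zero_iff_holds (hmod W)).mp hr0
  have hL' : W'.entireLFunction 1 ≠ 0 := by rwa [← entireLFunction_eq_of_isIsogenous' hiso]
  have hr0' : W'.analyticRank = 0 := analyticRank_eq_zero_of_entireLFunction_one_ne_zero W' hL'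
  have h' : BSDp W' p :=
    X1.bsdp_of_casselsTate_of_secondDescent W' p hCT hW hGZK hmod (by omega) hX' hr0' hq' hv' hx' hdiv'
  have h : BSDp W p :=
    X1.bsdp_of_casselsTate_of_secondDescent_of_isIsogenous_of_analyticRank_eq_zero W p hCT hW hGZK
      hmod hCassels W' hiso (by omega) hX' hr0 hq' hv' hx' hdiv'
  exact ⟨⟨h, h'⟩,
    (Rank1ResidualX1Converse.mazurMainConjecture_iff_bsdp hW16 hGr hmodP hGZK W p hX hr0).mpr h,
    (Rank1ResidualX1Converse.mazurMainConjecture_iff_bsdp hW16 hGr hmodP hGZK W' p hX' hr0').mpr h'⟩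

end MainConjecture

/-! ### §5 (appended 2026-08-27, g3) Class-free ISOGENOUS form — for rows outside X1 (e.g. row A10 / litref's
D4 ∩ {r = 0}) with the same `9 / 81` shape: the certificate on `W'`, Wuthrich's hypotheses on `W'` stated
directly (odd `p`, not additive at `p`, Borel-or-surjective image), conclusion `BSD(W,p) ∧ BSD(W',p)`. -/

section ClassFree

variable (W W' : WeierstrassCurve ℚ) [W.IsElliptic] [W.IsGloballyMinimal] [W'.IsElliptic]
  [W'.IsGloballyMinimal] (p : ℕ) [Fact p.Prime]

/-- **Class-free, up to isogeny:** `W ∼ W'` over `ℚ`, `L(W,1) ≠ 0`, `p` odd, `W'` not additive at `p` with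
Borel-or-surjective mod-`p` image, `#Ш(W'/ℚ)_an = q'` with `ord_p q' ≤ 4`, and the second-layer certificate
ON `W'` (`Ш(W')[p] ≠ 0`, `Ш(W')[p] ⊆ pШ(W')`) ⇒ `BSD(W,p) ∧ BSD(W',p)`: `BSD(W',p)` by
`bsdp_of_wuthrich_of_casselsTate_of_secondDescent` (`L(W',1) = L(W,1)` by Faltings, so `r_an(W') = 0`), and
`BSD(W,p)` by Cassels' isogeny invariance (`hCassels`, `bsdp_of_isIsogenous`). No class predicate is used.
[cite: Wuthrich2014, Prop. 21 (p. 400)] [cite: SilvermanAEC2009, Thm. X.4.14] [cite: MilneADT2006, Thm. I.7.3]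
[cite: Miller2011LMS, §1 and Def. 1.1] -/
theorem bsdp_pair_of_wuthrich_of_casselsTate_of_secondDescent_of_isIsogenous
    (hCT : exists_casselsTate_pairing (K := ℚ)) (hW : sha_dvd_analyticSha)
    (hGZK : rank_eq_analyticRank_of_analyticRank_le_one) (hmod : hasEntireLFunction_rat)
    (hCassels : bsdRHS_eq_of_isIsogenous) (hiso : IsIsogenous W W') (hp : p ≠ 2)
    (hL : W.entireLFunction 1 ≠ 0)
    (hadd' : ¬ ((W'.baseChange ℚ_[p]).minimal ℤ_[p]).HasAdditiveReduction ℤ_[p])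
    (himg' : ¬ W'.HasIrreducibleModPGaloisRep p ∨ W'.HasSurjectiveModNGaloisRep p)
    {q' : ℚ} (hq' : shaAn W' = (q' : ℂ)) (hv' : padicValRat p q' ≤ 4)
    (hx' : ∃ x : W'.sha, x ≠ 0 ∧ p • x = 0)
    (hdiv' : ∀ x : W'.sha, p • x = 0 → ∃ y : W'.sha, p • y = x) : BSDp W p ∧ BSDp W' p := by
  have hL' : W'.entireLFunction 1 ≠ 0 := by
    rwa [← entireLFunction_eq_of_isIsogenous' hiso]
  have hr0' : W'.analyticRank = 0 := analyticRank_eq_zero_of_entireLFunction_one_ne_zero W' hL'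
  have h' : BSDp W' p :=
    bsdp_of_wuthrich_of_casselsTate_of_secondDescent W' p hCT hW hGZK hmod hp hr0' hadd' himg' hq' hv'
      hx' hdiv'
  obtain ⟨-, hfin'⟩ := hGZK W' (by rw [hr0']; exact zero_le_one)
  have hlead : W'.leadingLCoeff ≠ 0 := by
    rwa [W'.leadingLCoeff_eq_of_analyticRank_eq_zero hr0']
  exact ⟨bsdp_of_isIsogenous hCassels hiso hfin' hlead h', h'⟩

/-- The same with `W.analyticRank = 0` in place of `L(W,1) ≠ 0` (modularity converts).
[cite: Wuthrich2014, Prop. 21 (p. 400)] [cite: MilneADT2006, Thm. I.7.3] [cite: BCDTJAMS2001, Theorem A] -/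
theorem bsdp_pair_of_wuthrich_of_casselsTate_of_secondDescent_of_isIsogenous_of_analyticRank_eq_zero
    (hCT : exists_casselsTate_pairing (K := ℚ)) (hW : sha_dvd_analyticSha)
    (hGZK : rank_eq_analyticRank_of_analyticRank_le_one) (hmod : hasEntireLFunction_rat)
    (hCassels : bsdRHS_eq_of_isIsogenous) (hiso : IsIsogenous W W') (hp : p ≠ 2)
    (hr0 : W.analyticRank = 0)
    (hadd' : ¬ ((W'.baseChange ℚ_[p]).minimal ℤ_[p]).HasAdditiveReduction ℤ_[p])
    (himg' : ¬ W'.HasIrreducibleModPGaloisRep p ∨ W'.HasSurjectiveModNGaloisRep p)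
    {q' : ℚ} (hq' : shaAn W' = (q' : ℂ)) (hv' : padicValRat p q' ≤ 4)
    (hx' : ∃ x : W'.sha, x ≠ 0 ∧ p • x = 0)
    (hdiv' : ∀ x : W'.sha, p • x = 0 → ∃ y : W'.sha, p • y = x) : BSDp W p ∧ BSDp W' p :=
  bsdp_pair_of_wuthrich_of_casselsTate_of_secondDescent_of_isIsogenous W W' p hCT hW hGZK hmod hCassels
    hiso hp ((W.analyticRank_eq_zero_iff_holds (hmod W)).mp hr0) hadd' himg' hq' hv' hx' hdiv'

end ClassFree

end Summit.BirchSwinnertonDyer.BirchSwinnertonDyer.Theorems.EisensteinPrimesMazurMCOnX1RankZeroSecondDescent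

end
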